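import Mathlib
import HarnessLib
import Summits.HubbardSuperconductivity.HubbardSuperconductivity.Theorems.KLProgrammeKLRegimeEnginePairTransferBudgetDressing

/-!
# Route `KLProgramme` — ENGINE child gen 8 (stmt-HubbardSuperconductivity-20437 `KLRegimeEngineV17F2`), skeleton v2 class #5 rev 3, (X).3 BUDGET ARITHMETIC (block B):
# the dressing functional is LINEAR and MONOTONE — `klbd_dressing_add`, `klbd_dressing_smul`, `klbd_dressing_mono`, `klbd_dressing_if`
# (cell gate-hubbard-kl, seat hubbard-kl-k3c1-p1 g15; row 79 of CLASS5-RESOLVED-STEP.md / KLTC-INDEX v12; companion of rows 77/78)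

WHY.  The budget row of candidate «76» dresses `Ran` by the functional
`𝒟[X](k,k′) = X(k,k′) + Σ_c X(k,c)ρ′(c)(3m/2) + Σ_a (3m/2)ρ(a)X(a,k′) + Σ_aΣ_c (3m/2)ρ(a)X(a,c)ρ′(c)(3m/2)`.  Rows 77/78 bound `𝒟` of each explicit TERM of `Ran`'s lower bound
(constants, `min` profiles); the assembly (B3) needs only that `𝒟` is additive (`klbd_dressing_add`), homogeneous (`klbd_dressing_smul`), monotone for `ρ, ρ′ ≥ 0`, `m ≥ 0`
(`klbd_dressing_mono`), and commutes with guards that do not depend on the momenta (`klbd_dressing_if`).  Stated with the functional written out (no definition is introduced).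
Pure algebra; nothing about the model is asserted; nothing asserts (X).3, (c), K3 or superconductivity.  0 kit · 0 lit.
-/

noncomputable section

namespace Summit.HubbardSuperconductivity.HubbardSuperconductivity.Theorems.KLRegimeSplit

set_option linter.dupNamespace false -- summit = problem name (single-conjunct summit), D-0017

open Finset

section Dressing

variable {ι : Type*} [Fintype ι]

/-- **Additivity** of the dressing functional. -/
theorem klbd_dressing_add (X Y : ι → ι → ℝ) (ρ ρ' : ι → ℝ) (m : ℝ) (k k' : ι) :
    (X k k' + Y k k') + ∑ c, (X k c + Y k c) * ρ' c * (3 / 2 * m) + ∑ a, 3 / 2 * m * ρ a * (X a k' + Y a k') +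
        ∑ a, ∑ c, 3 / 2 * m * ρ a * (X a c + Y a c) * ρ' c * (3 / 2 * m) =
      (X k k' + ∑ c, X k c * ρ' c * (3 / 2 * m) + ∑ a, 3 / 2 * m * ρ a * X a k' + ∑ a, ∑ c, 3 / 2 * m * ρ a * X a c * ρ' c * (3 / 2 * m)) +
      (Y k k' + ∑ c, Y k c * ρ' c * (3 / 2 * m) + ∑ a, 3 / 2 * m * ρ a * Y a k' + ∑ a, ∑ c, 3 / 2 * m * ρ a * Y a c * ρ' c * (3 / 2 * m)) := by
  have e1 : ∑ c, (X k c + Y k c) * ρ' c * (3 / 2 * m) = ∑ c, X k c * ρ' c * (3 / 2 * m) + ∑ c, Y k c * ρ' c * (3 / 2 * m) := by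
    rw [← Finset.sum_add_distrib]; exact Finset.sum_congr rfl fun c _ => by ring
  have e2 : ∑ a, 3 / 2 * m * ρ a * (X a k' + Y a k') = ∑ a, 3 / 2 * m * ρ a * X a k' + ∑ a, 3 / 2 * m * ρ a * Y a k' := by
    rw [← Finset.sum_add_distrib]; exact Finset.sum_congr rfl fun a _ => by ring
  have e3 : ∑ a, ∑ c, 3 / 2 * m * ρ a * (X a c + Y a c) * ρ' c * (3 / 2 * m) =
      ∑ a, ∑ c, 3 / 2 * m * ρ a * X a c * ρ' c * (3 / 2 * m) + ∑ a, ∑ c, 3 / 2 * m * ρ a * Y a c * ρ' c * (3 / 2 * m) := by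
    rw [← Finset.sum_add_distrib]
    refine Finset.sum_congr rfl fun a _ => ?_
    rw [← Finset.sum_add_distrib]; exact Finset.sum_congr rfl fun c _ => by ring
  rw [e1, e2, e3]; ring

/-- **Homogeneity** of the dressing functional (a scalar prefactor comes out). -/
theorem klbd_dressing_smul (X : ι → ι → ℝ) (ρ ρ' : ι → ℝ) (s m : ℝ) (k k' : ι) :
    s * X k k' + ∑ c, s * X k c * ρ' c * (3 / 2 * m) + ∑ a, 3 / 2 * m * ρ a * (s * X a k') + ∑ a, ∑ c, 3 / 2 * m * ρ a * (s * X a c) * ρ' c * (3 / 2 * m) =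
      s * (X k k' + ∑ c, X k c * ρ' c * (3 / 2 * m) + ∑ a, 3 / 2 * m * ρ a * X a k' + ∑ a, ∑ c, 3 / 2 * m * ρ a * X a c * ρ' c * (3 / 2 * m)) := by
  have e1 : ∑ c, s * X k c * ρ' c * (3 / 2 * m) = s * ∑ c, X k c * ρ' c * (3 / 2 * m) := by
    rw [Finset.mul_sum]; exact Finset.sum_congr rfl fun c _ => by ring
  have e2 : ∑ a, 3 / 2 * m * ρ a * (s * X a k') = s * ∑ a, 3 / 2 * m * ρ a * X a k' := by
    rw [Finset.mul_sum]; exact Finset.sum_congr rfl fun a _ => by ring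
  have e3 : ∑ a, ∑ c, 3 / 2 * m * ρ a * (s * X a c) * ρ' c * (3 / 2 * m) = s * ∑ a, ∑ c, 3 / 2 * m * ρ a * X a c * ρ' c * (3 / 2 * m) := by
    rw [Finset.mul_sum]
    refine Finset.sum_congr rfl fun a _ => ?_
    rw [Finset.mul_sum]; exact Finset.sum_congr rfl fun c _ => by ring
  rw [e1, e2, e3]; ring

/-- **Monotonicity** of the dressing functional (`ρ, ρ′ ≥ 0`, `m ≥ 0`). -/
theorem klbd_dressing_mono (X Y : ι → ι → ℝ) (ρ ρ' : ι → ℝ) {m : ℝ} (hm : 0 ≤ m) (hρ : ∀ a, 0 ≤ ρ a) (hρ' : ∀ c, 0 ≤ ρ' c)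
    (hXY : ∀ x y, X x y ≤ Y x y) (k k' : ι) :
    X k k' + ∑ c, X k c * ρ' c * (3 / 2 * m) + ∑ a, 3 / 2 * m * ρ a * X a k' + ∑ a, ∑ c, 3 / 2 * m * ρ a * X a c * ρ' c * (3 / 2 * m) ≤
      Y k k' + ∑ c, Y k c * ρ' c * (3 / 2 * m) + ∑ a, 3 / 2 * m * ρ a * Y a k' + ∑ a, ∑ c, 3 / 2 * m * ρ a * Y a c * ρ' c * (3 / 2 * m) := by
  have hm' : 0 ≤ 3 / 2 * m := by positivity
  refine add_le_add (add_le_add (add_le_add (hXY k k') (Finset.sum_le_sum fun c _ => ?_)) (Finset.sum_le_sum fun a _ => ?_))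
    (Finset.sum_le_sum fun a _ => Finset.sum_le_sum fun c _ => ?_)
  · exact mul_le_mul_of_nonneg_right (mul_le_mul_of_nonneg_right (hXY k c) (hρ' c)) hm'
  · exact mul_le_mul_of_nonneg_left (hXY a k') (mul_nonneg hm' (hρ a))
  · exact mul_le_mul_of_nonneg_right (mul_le_mul_of_nonneg_right (mul_le_mul_of_nonneg_left (hXY a c) (mul_nonneg hm' (hρ a))) (hρ' c)) hm'

/-- **Guards independent of the momenta commute with the dressing**: `𝒟[if P then X else Y] = if P then 𝒟[X] else 𝒟[Y]`. -/
theorem klbd_dressing_if (P : Prop) [Decidable P] (X Y : ι → ι → ℝ) (ρ ρ' : ι → ℝ) (m : ℝ) (k k' : ι) :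
    (if P then X k k' else Y k k') + ∑ c, (if P then X k c else Y k c) * ρ' c * (3 / 2 * m) + ∑ a, 3 / 2 * m * ρ a * (if P then X a k' else Y a k') +
        ∑ a, ∑ c, 3 / 2 * m * ρ a * (if P then X a c else Y a c) * ρ' c * (3 / 2 * m) =
      if P then X k k' + ∑ c, X k c * ρ' c * (3 / 2 * m) + ∑ a, 3 / 2 * m * ρ a * X a k' + ∑ a, ∑ c, 3 / 2 * m * ρ a * X a c * ρ' c * (3 / 2 * m)
      else Y k k' + ∑ c, Y k c * ρ' c * (3 / 2 * m) + ∑ a, 3 / 2 * m * ρ a * Y a k' + ∑ a, ∑ c, 3 / 2 * m * ρ a * Y a c * ρ' c * (3 / 2 * m) := by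
  split_ifs <;> rfl

end Dressing

end Summit.HubbardSuperconductivity.HubbardSuperconductivity.Theorems.KLRegimeSplit

end
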